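import Literature.MathematicalPhysics.QuantumFieldTheory.Balaban1983to89.B1Eq324BenfattoLemma
import HarnessLib

/-!
# `Balaban1983to89.B1Eq324BenfattoSect5ErrTermAbsorb` — [BenfattoEtAl1978] p. 159 «Collecting all the errors made in this process»: the
# two real-analysis absorptions that turn the per-step errors into the SHAPE of `B1Eq324BenfattoLemma.errTerm` —
# `e^{−b²/4} ≤ e^{27ρ⁴/4}·e^{−ρ·b^{3/2}}` and `b^q ≤ q!·ε^{−q}·e^{ε·b^{3/2}}` (`b ≥ 1`) — PROVED

statement-level skeleton of published theorems with citation tags; proofs where landed; nothing here is a claim about the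
Yang–Mills mass gap

WHY THIS MODULE (cell `pub-ymgap`, seat `dag-n08-c`, node N08; the grand assembly (R4)).  `errTerm S ρ₁ ρ₂ ρ₃ ρ₄ A b t =
S·((A·b^{ρ₁}·e^{ρ₂Ab^{ρ₃}})^{t+1} + e^{−ρ₃b^{3/2}}·e^{ρ₄Ab^{ρ₃}})` has ONE decay exponent `ρ₃` (faithful to print's (4.6)); the per-step errors
come as `poly(b)·e^{−b²/4}` (small-field volume, `χ → 1`) and `poly(b)·A^j·e^{−r·w}` with `w ≍ M·b^{3/2}` (conditioning / Appendix D /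
(5.11) — `…Sect5HlCumulants`, `…Sect5FreeStepCross`, `…PerBoxAppD`).  To land them in the second summand one needs exactly: the Gaussian tail
beats any `e^{−ρb^{3/2}}` up to a constant, and polynomial prefactors in `b` are absorbed by an arbitrarily small exponential slack.

WHAT IS PROVED (theorems only; no definition, no named fact, no `sorry`; axioms standard).
* private `quartic_absorb` — `ρu³ − u⁴/4 ≤ 27ρ⁴/4` for all real `u, ρ` (`u⁴ − 4ρu³ + 27ρ⁴ = (u−3ρ)²((u+ρ)²+2ρ²)`).
* ★ `exp_neg_sq_div_four_le_exp_neg_rpow` — for `b ≥ 0` and any `ρ`: `e^{−b²/4} ≤ e^{27ρ⁴/4}·e^{−ρ·b^{3/2}}` (`b^{3/2} = Real.rpow b (3/2)`).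
* ★ `pow_le_factorial_mul_exp_rpow` — for `b ≥ 1`, `ε > 0`, `q : ℕ`: `b^q ≤ q!/ε^q · e^{ε·b^{3/2}}` (`Real.pow_div_factorial_le_exp` at `εb^{3/2}`
  and `b ≤ b^{3/2}`).

HONEST SCOPE / NOT HERE.  Elementary real analysis; the choice of the constants `S, ρ₁…ρ₄, b*` is the assembly's; `BasicLemmaPrinted` stays
OPEN.  NOT summit progress; count-neutral for N08; nothing of [Balaban1985UV3] is asserted.
-/

namespace Literature.MathematicalPhysics.QuantumFieldTheory.Balaban1983to89.B1Eq324BenfattoSect5ErrTermAbsorb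

/-- `ρu³ − u⁴/4 ≤ 27ρ⁴/4` — since `u⁴ − 4ρu³ + 27ρ⁴ = (u − 3ρ)²·((u + ρ)² + 2ρ²) ≥ 0`. [folklore] -/
private theorem quartic_absorb (u ρ : ℝ) : ρ * u ^ 3 - u ^ 4 / 4 ≤ 27 / 4 * ρ ^ 4 := by
  have h : (u - 3 * ρ) ^ 2 * ((u + ρ) ^ 2 + 2 * ρ ^ 2) = u ^ 4 - 4 * ρ * u ^ 3 + 27 * ρ ^ 4 := by ring
  have h0 : 0 ≤ (u - 3 * ρ) ^ 2 * ((u + ρ) ^ 2 + 2 * ρ ^ 2) := by positivity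
  linarith

/-- **THE GAUSSIAN TAIL BEATS ANY `e^{−ρb^{3/2}}`**: for `b ≥ 0` and any real `ρ`, `e^{−b²/4} ≤ e^{27ρ⁴/4}·e^{−ρ·b^{3/2}}` — the
small-field volume errors `∝ e^{−b²/4}` of §5 fit the `e^{−ρ₃b^{3/2}}` summand of `errTerm` with `S ≥ e^{27ρ₃⁴/4}·(…)`.
[cite: BenfattoEtAl1978, (4.6)–(4.7) p.152 and p.159] -/
theorem exp_neg_sq_div_four_le_exp_neg_rpow {b : ℝ} (hb : 0 ≤ b) (ρ : ℝ) :
    Real.exp (-(b ^ 2 / 4)) ≤ Real.exp (27 / 4 * ρ ^ 4) * Real.exp (-(ρ * b ^ (3 / 2 : ℝ))) := by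
  rw [← Real.exp_add, Real.exp_le_exp]
  set u : ℝ := Real.sqrt b with hu
  have hu0 : 0 ≤ u := Real.sqrt_nonneg b
  have hb2 : b = u ^ 2 := by rw [hu, Real.sq_sqrt hb]
  have h32 : b ^ (3 / 2 : ℝ) = u ^ 3 := by
    rw [hb2, ← Real.rpow_natCast u 2, ← Real.rpow_mul hu0]
    norm_num
  rw [h32, hb2]
  have h4 : (u ^ 2) ^ 2 = u ^ 4 := by ring
  rw [h4]
  have := quartic_absorb u ρ
  linarith

/-- **POLYNOMIAL PREFACTORS ARE ABSORBED BY AN EXPONENTIAL SLACK**: for `b ≥ 1`, `ε > 0` and `q : ℕ`,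
`b^q ≤ (q!/ε^q)·e^{ε·b^{3/2}}` — `(εb^{3/2})^q/q! ≤ e^{εb^{3/2}}` and `b ≤ b^{3/2}`; so `b^q·e^{−r·b^{3/2}} ≤ (q!/ε^q)·e^{−(r−ε)b^{3/2}}`.
[cite: BenfattoEtAl1978, (4.6)–(4.7) p.152 and p.159] -/
theorem pow_le_factorial_mul_exp_rpow {b ε : ℝ} (hb : 1 ≤ b) (hε : 0 < ε) (q : ℕ) :
    b ^ q ≤ (q.factorial : ℝ) / ε ^ q * Real.exp (ε * b ^ (3 / 2 : ℝ)) := by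
  have hb0 : 0 ≤ b := zero_le_one.trans hb
  have hX0 : 0 ≤ b ^ (3 / 2 : ℝ) := Real.rpow_nonneg hb0 _
  -- `b ≤ b^{3/2}`
  have hbX : b ≤ b ^ (3 / 2 : ℝ) := by
    calc b = b ^ (1 : ℝ) := (Real.rpow_one b).symm
      _ ≤ b ^ (3 / 2 : ℝ) := Real.rpow_le_rpow_of_exponent_le hb (by norm_num)
  have h1 : b ^ q ≤ (b ^ (3 / 2 : ℝ)) ^ q := pow_le_pow_left₀ hb0 hbX q
  have h2 := Real.pow_div_factorial_le_exp (ε * b ^ (3 / 2 : ℝ)) (mul_nonneg hε.le hX0) q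
  -- `(εX)^q / q! ≤ e^{εX}` ⇒ `X^q ≤ q!/ε^q · e^{εX}`
  have hq : (0 : ℝ) < (q.factorial : ℝ) := by positivity
  have hεq : 0 < ε ^ q := pow_pos hε q
  rw [mul_pow, div_le_iff₀ hq] at h2
  calc b ^ q ≤ (b ^ (3 / 2 : ℝ)) ^ q := h1
    _ = (ε ^ q * (b ^ (3 / 2 : ℝ)) ^ q) / ε ^ q := by field_simp
    _ ≤ (Real.exp (ε * b ^ (3 / 2 : ℝ)) * (q.factorial : ℝ)) / ε ^ q := div_le_div_of_nonneg_right h2 hεq.le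
    _ = (q.factorial : ℝ) / ε ^ q * Real.exp (ε * b ^ (3 / 2 : ℝ)) := by ring

end Literature.MathematicalPhysics.QuantumFieldTheory.Balaban1983to89.B1Eq324BenfattoSect5ErrTermAbsorb
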